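import Literature.Probability.LatticeModels.BoxDirichlet
import Literature.Probability.LatticeModels.LatticeLaplacianZd
import HarnessLib

/-!
# Lattice-harmonic functions at a flat Dirichlet row: odd reflection and linear behaviour

Topic `Literature/Probability/LatticeModels` (discrete potential theory on `ℤ²`, continuing
`LatticeLaplacian.lean` / `BoxDirichlet.lean`). First instalment of the discharge programme for
the named fact `Kenyon2000_flatEdgePoissonKernelLimit` (`FlatBoundaryPoissonKernelLimit.lean`;
R. Kenyon, *Conformal invariance of domino tiling*, Ann. Probab. 28 (2000), Cor. 19): the value of
a Dirichlet Green function on the lattice row adjacent to a flat piece of the killed boundary,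
divided by the mesh, converges to the inner normal derivative of the continuum Green function.
Kenyon's proof of Cor. 19 reflects the graph oddly across the flat boundary row, which turns the
boundary-row value into an interior discrete derivative. This file proves the purely discrete
half of that argument, in a form that needs no continuum input:

* `latticeLaplacian_eq_latticeLaplacianZd`, `isLatticeHarmonicOn_iff_isZdHarmonicOn` — the two
  planar Laplacians of the tree (`latticeLaplacian`, steps `cornerUnit k`; `latticeLaplacianZd`,
  steps `± Pi.single i 1`, the one behind `dirichletGreen`) agree.
* `abs_step_le_of_harmonic_near` — the interior gradient estimate of `BoxDirichlet.lean`
  (`harmonic_box_gradient_le`) recentred: `h` harmonic on the open box of radius `q ≥ 8` about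
  `x` and `|h| ≤ M` on the closed box give `|h (x + e_k) - h x| ≤ 2 K M / q`
  (`K = topGradConst`).
* `oddRowExt r h` — the odd extension of `h` across the row `x₁ = r`
  (`(i, j) ↦ -h (i, 2r - j)` below the row); `latticeLaplacian_oddRowExt` — if `h` vanishes on
  the row and is harmonic on the `L` rows above it, the extension is harmonic on the `2L + 1`
  rows centred at the row (Kenyon 2000, proof of Cor. 19: "a harmonic function … which is zero on
  the boundary extends to a harmonic function on this glued graph by setting `f(v') = -f(v)`").
* **`abs_sub_mul_le_of_harmonic_above_row`** — the boundary-row linearisation: if `h = 0` on the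
  row `p₁ - 1`, `h` is harmonic on the columns `|i - p₀| ≤ 8s` of the rows `p₁ … p₁ + 8s` and
  `|h| ≤ M` one layer around, then for `J ≤ 2s`
  `|h (p₀, p₁ + J) - (J + 1) h (p₀, p₁)| ≤ K² M J (J + 1) / (2 s²)`:
  the vertical difference of the odd extension is harmonic with `|·| ≤ K M /(2s)` (first
  gradient estimate), so its own vertical differences are `≤ K² M/(2 s²)` (second gradient
  estimate), and the values `h (p₀, p₁ + J) = ∑_{j ≤ J} (differences)` are `(J+1) h(p₀, p₁)` up to
  the triangular sum of these second differences. Dividing by `(J+1) · mesh` this says that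
  `h(p)/mesh` equals the difference quotient of `h` over `J + 1` meshes in the normal direction up
  to `O(M J / s²)`, which is how the boundary-row value of the Green function is compared with the
  normal derivative of its continuum limit.

Everything is proved; no named fact is introduced; all statements are [folklore] discrete
potential theory (Kenyon 2000, proof of Cor. 19, for the reflection).

## References

* R. Kenyon, *Conformal invariance of domino tiling*, Ann. Probab. 28 (2000) 759–795, Lemma 17 and
  Corollary 19 (arXiv:math-ph/9910002) — bib key `Kenyon2000`.
* G. F. Lawler, V. Limic, *Random Walk: A Modern Introduction* (2010), Thm. 6.3.8 (difference
  estimates for discrete harmonic functions).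
-/

noncomputable section

namespace Literature.Probability.LatticeModels

open Finset

/-! ### The two planar Laplacians agree -/

/-- The four-neighbour Laplacian `latticeLaplacian` (steps `cornerUnit k`) is the `d = 2` case of
`latticeLaplacianZd` (steps `± Pi.single i 1`). [folklore] -/
theorem latticeLaplacian_eq_latticeLaplacianZd (H : Site 2 → ℝ) (v : Site 2) :
    latticeLaplacian H v = latticeLaplacianZd H v := by
  rw [latticeLaplacian, Fin.sum_univ_four, latticeLaplacianZd_def, Fin.sum_univ_two]
  simp only [cornerUnit, ← sub_eq_add_neg]
  push_cast
  ring

/-- Planar lattice harmonicity in the two languages of the tree agrees. [folklore] -/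
theorem isLatticeHarmonicOn_iff_isZdHarmonicOn (H : Site 2 → ℝ) (S : Set (Site 2)) :
    IsLatticeHarmonicOn H S ↔ IsZdHarmonicOn H S := by
  simp only [IsLatticeHarmonicOn, IsZdHarmonicOn, latticeLaplacian_eq_latticeLaplacianZd]

/-! ### Coordinates -/

/-- A planar site is the pair of its coordinates (cf. `Literature.Probability.Percolation.site_eta`,
not imported to keep this file inside the lattice-potential-theory import cone). [folklore] -/
theorem site_two_eta (y : Site 2) : (![y 0, y 1] : Site 2) = y := by
  ext i; fin_cases i <;> rfl

/-- `x + e₁ = (x₀, x₁ + 1)`. [folklore] -/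
theorem add_cornerUnit_one_eq (x : Site 2) : x + cornerUnit 1 = ![x 0, x 1 + 1] := by
  ext i; fin_cases i <;> simp [cornerUnit]

/-- The lattice Laplacian of an arbitrary function in coordinates. [folklore] -/
theorem latticeLaplacian_coord' (h : Site 2 → ℝ) (x : Site 2) :
    latticeLaplacian h x =
      h ![x 0 + 1, x 1] + h ![x 0, x 1 + 1] + h ![x 0 - 1, x 1] + h ![x 0, x 1 - 1] - 4 * h x := by
  have hfun : h = fun y : Site 2 => (fun i j : ℤ => h ![i, j]) (y 0) (y 1) := by
    funext y; simp only [site_two_eta]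
  rw [hfun]
  refine (latticeLaplacian_coord (fun i j : ℤ => h ![i, j]) x).trans ?_
  simp only [site_two_eta]

/-! ### The interior gradient estimate, recentred -/

/-- **Interior gradient estimate about a point.** If `h` is lattice-harmonic on the open box of
radius `q ≥ 8` about `x` and `|h| ≤ M` on the closed box of radius `q`, then
`|h (x + e_k) - h x| ≤ 2 K M / q` for the four lattice directions (`K = topGradConst`;
`harmonic_box_gradient_le` for the box of side `2q` cornered at `x - (q, q)`). [folklore] -/
theorem abs_step_le_of_harmonic_near {h : Site 2 → ℝ} {x : Site 2} {q : ℕ} (hq : 8 ≤ q)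
    (hh : ∀ y : Site 2, x 0 - q < y 0 → y 0 < x 0 + q → x 1 - q < y 1 → y 1 < x 1 + q →
      latticeLaplacian h y = 0)
    {M : ℝ} (hM0 : 0 ≤ M)
    (hM : ∀ y : Site 2, x 0 - q ≤ y 0 → y 0 ≤ x 0 + q → x 1 - q ≤ y 1 → y 1 ≤ x 1 + q → |h y| ≤ M)
    (k : Fin 4) : |h (x + cornerUnit k) - h x| ≤ 2 * topGradConst * M / q := by
  have hN : 16 ≤ 2 * q := by omega
  have hharm : IsLatticeHarmonicOn h (boxInterior (cornerOf x q) (2 * q)) := by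
    intro y hy
    obtain ⟨k0, k0', k1, k1'⟩ := hy
    simp only [cornerOf, Matrix.cons_val_zero, Matrix.cons_val_one] at k0 k0' k1 k1'
    push_cast at k0 k0' k1 k1'
    exact hh y (by linarith) (by linarith) (by linarith) (by linarith)
  have hsides : ∀ i : ℕ, 0 < i → i < 2 * q →
      |h ![cornerOf x q 0 + i, cornerOf x q 1 + (2 * q : ℕ)]| ≤ M ∧
      |h ![cornerOf x q 0 + i, cornerOf x q 1]| ≤ M ∧
      |h ![cornerOf x q 0, cornerOf x q 1 + i]| ≤ M ∧
      |h ![cornerOf x q 0 + (2 * q : ℕ), cornerOf x q 1 + i]| ≤ M := by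
    intro i hi hiq
    refine ⟨hM _ ?_ ?_ ?_ ?_, hM _ ?_ ?_ ?_ ?_, hM _ ?_ ?_ ?_ ?_, hM _ ?_ ?_ ?_ ?_⟩
    all_goals
      simp only [cornerOf, Matrix.cons_val_zero, Matrix.cons_val_one]
      push_cast
      omega
  have hq0 : (0 : ℝ) < q := by exact_mod_cast (show 0 < q by omega)
  calc |h (x + cornerUnit k) - h x| ≤ 4 * topGradConst * M / (2 * q : ℕ) :=
        harmonic_box_gradient_le (cornerOf x q) (2 * q) hN hharm hM0 hsides (mem_boxMiddle_cornerOf x q) k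
    _ = 2 * topGradConst * M / q := by
        push_cast
        field_simp
        ring

/-! ### Odd reflection across a row -/

/-- The **odd extension** of `h` across the row `x₁ = r`: `h` itself on and above the row, and
`(i, j) ↦ -h (i, 2r - j)` strictly below it (Kenyon 2000, proof of Cor. 19: "setting
`f(v') = -f(v)` when `v'` is the reflection of `v`"). [cite: Kenyon2000, proof of Cor. 19] -/
def oddRowExt (r : ℤ) (h : Site 2 → ℝ) : Site 2 → ℝ := fun y =>
  if r ≤ y 1 then h y else -h ![y 0, 2 * r - y 1]

/-- The odd extension on and above the row. [folklore] -/
theorem oddRowExt_apply_of_le {r : ℤ} (h : Site 2 → ℝ) {i j : ℤ} (hj : r ≤ j) :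
    oddRowExt r h ![i, j] = h ![i, j] := by
  simp [oddRowExt, hj]

/-- The odd extension strictly below the row. [folklore] -/
theorem oddRowExt_apply_of_lt {r : ℤ} (h : Site 2 → ℝ) {i j : ℤ} (hj : j < r) :
    oddRowExt r h ![i, j] = -h ![i, 2 * r - j] := by
  simp [oddRowExt, not_le.2 hj]

/-- **The odd extension of a harmonic function vanishing on the row is harmonic across the row.**
If `h = 0` at the sites `(i, r)`, `|i - c| ≤ m + 1`, and `h` is lattice-harmonic at the sites
`(i, j)` with `|i - c| ≤ m`, `r + 1 ≤ j ≤ r + L`, then `oddRowExt r h` is lattice-harmonic at every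
`(i, j)` with `|i - c| ≤ m` and `|j - r| ≤ L` (on the row the two vertical neighbours cancel and the
horizontal ones vanish; below the row the Laplacian is minus the Laplacian at the mirror site).
[cite: Kenyon2000, proof of Cor. 19] -/
theorem latticeLaplacian_oddRowExt {h : Site 2 → ℝ} {r c : ℤ} {m L : ℕ}
    (hzero : ∀ i : ℤ, c - (m + 1) ≤ i → i ≤ c + (m + 1) → h ![i, r] = 0)
    (hharm : ∀ i j : ℤ, c - m ≤ i → i ≤ c + m → r + 1 ≤ j → j ≤ r + L →
      latticeLaplacian h ![i, j] = 0)
    {i j : ℤ} (hi : c - m ≤ i) (hi' : i ≤ c + m) (hj : r - L ≤ j) (hj' : j ≤ r + L) :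
    latticeLaplacian (oddRowExt r h) ![i, j] = 0 := by
  rw [latticeLaplacian_coord']
  simp only [Matrix.cons_val_zero, Matrix.cons_val_one]
  rcases lt_trichotomy j r with hlt | rfl | hgt
  · -- strictly below the row: minus the Laplacian of `h` at the mirror site `(i, 2r - j)`
    have key := hharm i (2 * r - j) hi hi' (by omega) (by omega)
    rw [latticeLaplacian_coord'] at key
    simp only [Matrix.cons_val_zero, Matrix.cons_val_one] at key
    have hup : oddRowExt r h ![i, j + 1] = -h ![i, 2 * r - j - 1] := by
      rcases lt_or_eq_of_le (show j + 1 ≤ r by omega) with h1 | h1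
      · rw [oddRowExt_apply_of_lt h h1, show 2 * r - (j + 1) = 2 * r - j - 1 by ring]
      · rw [h1, oddRowExt_apply_of_le h le_rfl, hzero i (by omega) (by omega),
          show 2 * r - j - 1 = r by omega, hzero i (by omega) (by omega), neg_zero]
    rw [oddRowExt_apply_of_lt h hlt, oddRowExt_apply_of_lt h hlt, oddRowExt_apply_of_lt h hlt, hup,
      oddRowExt_apply_of_lt h (show j - 1 < r by omega), show 2 * r - (j - 1) = 2 * r - j + 1 by ring]
    linarith
  · -- on the row
    rw [oddRowExt_apply_of_le h le_rfl, oddRowExt_apply_of_le h le_rfl, oddRowExt_apply_of_le h le_rfl,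
      oddRowExt_apply_of_le h (show j ≤ j + 1 by omega), oddRowExt_apply_of_lt h (show j - 1 < j by omega),
      show 2 * j - (j - 1) = j + 1 by ring, hzero i (by omega) (by omega), hzero (i + 1) (by omega) (by omega),
      hzero (i - 1) (by omega) (by omega)]
    ring
  · -- strictly above the row: the Laplacian of `h` itself
    have key := hharm i j hi hi' (by omega) hj'
    rw [latticeLaplacian_coord'] at key
    simp only [Matrix.cons_val_zero, Matrix.cons_val_one] at key
    rw [oddRowExt_apply_of_le h hgt.le, oddRowExt_apply_of_le h hgt.le, oddRowExt_apply_of_le h hgt.le,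
      oddRowExt_apply_of_le h (show r ≤ j + 1 by omega), oddRowExt_apply_of_le h (show r ≤ j - 1 by omega)]
    exact key

/-! ### Linear behaviour at the boundary row -/

/-- **Boundary-row linearisation of a lattice-harmonic function at a flat Dirichlet row.** Let
`s ≥ 4`, `p` a site, and suppose: `h = 0` at the sites `(i, p₁ - 1)` with `|i - p₀| ≤ 8s + 1` (the
killed row), `h` is lattice-harmonic at the sites `(i, j)` with `|i - p₀| ≤ 8s`,
`p₁ ≤ j ≤ p₁ + 8s`, and `|h| ≤ M` at the sites `(i, j)` with `|i - p₀| ≤ 8s + 1`,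
`p₁ - 1 ≤ j ≤ p₁ + 8s + 1`. Then for every `J ≤ 2s`,
`|h (p₀, p₁ + J) - (J + 1) h p| ≤ K² M J (J + 1) / (2 s²)` with `K = topGradConst`.
Proof: the vertical difference `F` of the odd extension `E = oddRowExt (p₁ - 1) h` is harmonic and
bounded by `K M/(2s)` on the box of radius `4s` about `(p₀, p₁ - 1)` (`abs_step_le_of_harmonic_near`
for `E`), hence its vertical differences are at most `K² M/(2s²)` on the column `p₀` within `2s`
rows (`abs_step_le_of_harmonic_near` for `F`); and `h (p₀, p₁ + J) = ∑_{j ≤ J} F (p₀, p₁ - 1 + j)`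
with `F (p₀, p₁ - 1) = h p`. This is the discrete half of Kenyon's proof of Cor. 19 (reflection
across the boundary row turns the boundary-row value into an interior difference, to which the
interior estimates apply). [cite: Kenyon2000, proof of Cor. 19] -/
theorem abs_sub_mul_le_of_harmonic_above_row {h : Site 2 → ℝ} {p : Site 2} {s : ℕ} (hs : 4 ≤ s)
    {M : ℝ} (hM0 : 0 ≤ M)
    (hzero : ∀ i : ℤ, p 0 - (8 * s + 1) ≤ i → i ≤ p 0 + (8 * s + 1) → h ![i, p 1 - 1] = 0)
    (hharm : ∀ i j : ℤ, p 0 - 8 * s ≤ i → i ≤ p 0 + 8 * s → p 1 ≤ j → j ≤ p 1 + 8 * s →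
      latticeLaplacian h ![i, j] = 0)
    (hbd : ∀ i j : ℤ, p 0 - (8 * s + 1) ≤ i → i ≤ p 0 + (8 * s + 1) → p 1 - 1 ≤ j →
      j ≤ p 1 + (8 * s + 1) → |h ![i, j]| ≤ M)
    {J : ℕ} (hJ : J ≤ 2 * s) :
    |h ![p 0, p 1 + J] - (J + 1) * h p| ≤ topGradConst ^ 2 * M * J * (J + 1) / (2 * s ^ 2) := by
  have hK := topGradConst_pos
  have hs0 : (0 : ℝ) < s := by exact_mod_cast (show 0 < s by omega)
  set r : ℤ := p 1 - 1 with hr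
  set E : Site 2 → ℝ := oddRowExt r h with hE
  -- `E` is harmonic on the box `|i - p₀| ≤ 8s`, `|j - r| ≤ 8s + 1`
  have hEharm : ∀ i j : ℤ, p 0 - 8 * s ≤ i → i ≤ p 0 + 8 * s → r - (8 * s + 1) ≤ j →
      j ≤ r + (8 * s + 1) → latticeLaplacian E ![i, j] = 0 := by
    intro i j h1 h2 h3 h4
    refine latticeLaplacian_oddRowExt (c := p 0) (m := 8 * s) (L := 8 * s + 1)
      (fun i' g1 g2 => hzero i' (by push_cast at g1 ⊢; omega) (by push_cast at g2 ⊢; omega))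
      (fun i' j' g1 g2 g3 g4 => hharm i' j' (by push_cast at g1 ⊢; omega) (by push_cast at g2 ⊢; omega)
        (by omega) (by push_cast at g4 ⊢; omega))
      (by push_cast; omega) (by push_cast; omega) (by push_cast; omega) (by push_cast; omega)
  -- `|E| ≤ M` on the box `|i - p₀| ≤ 8s + 1`, `|j - r| ≤ 8s + 2`
  have hEbd : ∀ i j : ℤ, p 0 - (8 * s + 1) ≤ i → i ≤ p 0 + (8 * s + 1) → r - (8 * s + 2) ≤ j →
      j ≤ r + (8 * s + 2) → |E ![i, j]| ≤ M := by
    intro i j h1 h2 h3 h4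
    by_cases hjr : r ≤ j
    · rw [hE, oddRowExt_apply_of_le h hjr]; exact hbd i j h1 h2 (by omega) (by omega)
    · rw [hE, oddRowExt_apply_of_lt h (not_le.1 hjr), abs_neg]
      exact hbd i (2 * r - j) h1 h2 (by omega) (by omega)
  -- first differences of `E`: `|E (y + e₁) - E y| ≤ M₁` for `|y₀ - p₀| ≤ 4s`, `|y₁ - r| ≤ 4s`
  set M₁ : ℝ := 2 * topGradConst * M / (4 * s : ℕ) with hM₁
  have hM₁0 : 0 ≤ M₁ := by positivity
  have hstep1 : ∀ i j : ℤ, p 0 - 4 * s ≤ i → i ≤ p 0 + 4 * s → r - 4 * s ≤ j → j ≤ r + 4 * s →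
      |E (![i, j] + cornerUnit 1) - E ![i, j]| ≤ M₁ := by
    intro i j h1 h2 h3 h4
    refine abs_step_le_of_harmonic_near (q := 4 * s) (by omega) (fun y g1 g2 g3 g4 => ?_) hM0
      (fun y g1 g2 g3 g4 => ?_) 1
    · simp only [Matrix.cons_val_zero, Matrix.cons_val_one] at g1 g2 g3 g4
      push_cast at g1 g2 g3 g4
      have := hEharm (y 0) (y 1) (by omega) (by omega) (by omega) (by omega)
      rwa [site_two_eta] at this
    · simp only [Matrix.cons_val_zero, Matrix.cons_val_one] at g1 g2 g3 g4
      push_cast at g1 g2 g3 g4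
      have := hEbd (y 0) (y 1) (by omega) (by omega) (by omega) (by omega)
      rwa [site_two_eta] at this
  -- the vertical difference `F` of `E` is harmonic where `E` is harmonic at `y` and `y + e₁`
  set F : Site 2 → ℝ := fun y => E (y + cornerUnit 1) - E y with hF
  have hFharm : ∀ y : Site 2, p 0 - 8 * s ≤ y 0 → y 0 ≤ p 0 + 8 * s → r - 8 * s ≤ y 1 →
      y 1 ≤ r + 8 * s → latticeLaplacian F y = 0 := by
    intro y h1 h2 h3 h4
    have e1 := hEharm (y 0) (y 1) h1 h2 (by omega) (by omega)
    have e2 := hEharm (y 0) (y 1 + 1) h1 h2 (by omega) (by omega)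
    rw [latticeLaplacian_coord'] at e1 e2 ⊢
    simp only [hF, add_cornerUnit_one_eq, Matrix.cons_val_zero, Matrix.cons_val_one, site_two_eta, add_sub_cancel_right, sub_add_cancel] at e1 e2 ⊢
    linarith
  -- second differences: `|F (y + e₁) - F y| ≤ M₂` on the column `p₀`, `|y₁ - r| ≤ 2s`
  set M₂ : ℝ := 2 * topGradConst * M₁ / (2 * s : ℕ) with hM₂
  have hstep2 : ∀ j : ℤ, r - 2 * s ≤ j → j ≤ r + 2 * s →
      |F (![p 0, j] + cornerUnit 1) - F ![p 0, j]| ≤ M₂ := by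
    intro j h3 h4
    refine abs_step_le_of_harmonic_near (q := 2 * s) (by omega) (fun y g1 g2 g3 g4 => ?_) hM₁0
      (fun y g1 g2 g3 g4 => ?_) 1
    · simp only [Matrix.cons_val_zero, Matrix.cons_val_one] at g1 g2 g3 g4
      push_cast at g1 g2 g3 g4
      exact hFharm y (by omega) (by omega) (by omega) (by omega)
    · simp only [Matrix.cons_val_zero, Matrix.cons_val_one] at g1 g2 g3 g4
      push_cast at g1 g2 g3 g4
      have := hstep1 (y 0) (y 1) (by omega) (by omega) (by omega) (by omega)
      rwa [site_two_eta] at this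
  -- the differences along the column `p₀`: `d j = F (p₀, r + j)`, `d 0 = h p`
  set d : ℕ → ℝ := fun j => F ![p 0, r + j] with hd
  have hd0 : d 0 = h p := by
    simp only [hd, hF, Nat.cast_zero, add_zero, add_cornerUnit_one_eq, Matrix.cons_val_zero,
      Matrix.cons_val_one]
    rw [hE, oddRowExt_apply_of_le h (show r ≤ r + 1 by omega), oddRowExt_apply_of_le h le_rfl,
      hzero (p 0) (by omega) (by omega), sub_zero, show r + 1 = p 1 by omega, site_two_eta]
  have hdstep : ∀ j : ℕ, j + 1 ≤ 2 * s → |d (j + 1) - d j| ≤ M₂ := by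
    intro j hj
    have := hstep2 (r + j) (by omega) (by omega)
    simp only [hd]
    rw [add_cornerUnit_one_eq] at this
    simp only [Matrix.cons_val_zero, Matrix.cons_val_one] at this
    push_cast
    rwa [← add_assoc]
  have hdiff : ∀ j : ℕ, j ≤ 2 * s → |d j - d 0| ≤ j * M₂ := by
    intro j hj
    induction j with
    | zero => simp
    | succ n ih =>
      have h1 := ih (by omega)
      have h2 := hdstep n (by omega)
      calc |d (n + 1) - d 0| = |(d (n + 1) - d n) + (d n - d 0)| := by ring_nf
        _ ≤ |d (n + 1) - d n| + |d n - d 0| := abs_add_le _ _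
        _ ≤ M₂ + n * M₂ := add_le_add h2 h1
        _ = (n + 1 : ℕ) * M₂ := by push_cast; ring
  -- telescoping: `∑_{j ≤ J} d j = h (p₀, p₁ + J)`
  have hsum : ∑ j ∈ range (J + 1), d j = h ![p 0, p 1 + J] := by
    have htel := Finset.sum_range_sub (fun j : ℕ => E ![p 0, r + j]) (J + 1)
    have hterm : ∀ j ∈ range (J + 1), E ![p 0, r + ((j + 1 : ℕ) : ℤ)] - E ![p 0, r + (j : ℤ)] = d j := by
      intro j _
      simp only [hd, hF, add_cornerUnit_one_eq, Matrix.cons_val_zero, Matrix.cons_val_one]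
      push_cast
      rw [add_assoc]
    rw [Finset.sum_congr rfl hterm] at htel
    rw [htel, Nat.cast_zero, add_zero, hE, oddRowExt_apply_of_le h le_rfl, hzero (p 0) (by omega) (by omega),
      sub_zero, oddRowExt_apply_of_le h (by push_cast; omega),
      show r + ((J + 1 : ℕ) : ℤ) = p 1 + (J : ℤ) by push_cast; omega]
  -- conclusion
  have hrepr : h ![p 0, p 1 + J] - (J + 1) * h p = ∑ j ∈ range (J + 1), (d j - d 0) := by
    rw [Finset.sum_sub_distrib, hsum, Finset.sum_const, Finset.card_range, nsmul_eq_mul, hd0]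
    push_cast
    ring
  have hM₂eq : topGradConst ^ 2 * M * J * (J + 1) / (2 * s ^ 2) = (J + 1) * (J * M₂) := by
    simp only [hM₂, hM₁]
    push_cast
    field_simp
    ring
  rw [hrepr, hM₂eq]
  calc |∑ j ∈ range (J + 1), (d j - d 0)| ≤ ∑ j ∈ range (J + 1), |d j - d 0| :=
        Finset.abs_sum_le_sum_abs _ _
    _ ≤ ∑ j ∈ range (J + 1), (J : ℝ) * M₂ := Finset.sum_le_sum fun j hj => by
        have hjJ : j ≤ J := Nat.lt_succ_iff.1 (Finset.mem_range.1 hj)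
        calc |d j - d 0| ≤ j * M₂ := hdiff j (by omega)
          _ ≤ J * M₂ := by
              have : (j : ℝ) ≤ J := by exact_mod_cast hjJ
              have hM₂0 : 0 ≤ M₂ := by positivity
              nlinarith
    _ = (J + 1) * (J * M₂) := by
        rw [Finset.sum_const, Finset.card_range, nsmul_eq_mul]
        push_cast
        ring

end Literature.Probability.LatticeModels
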